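import Literature.NumberTheory.EllipticCurves.Tian2014.CMPointSystemPiPrimeClass
import HarnessLib

/-!
# The principal-genus sentence of Tian 2014, Notations (ii) — «the subgroup `2𝒜 ≃ Gal(H/H₀)`, i.e. the class of
# `t ∈ 2𝒜` if and only if `σ_t` fixes all `√p*_j`» — as a KERNEL THEOREM of the other displayed statements on `𝒮⁻`:
# the displayed hypothesis of the route-A corner reduced by a FOURTH sentence, with the reduced fact EQUIVALENT to it

Cell `bsd-monsky` (typer seat, g13). A second pass of the DERIVABILITY audit of the displayed hypothesis of the route-A
corner (`tian2014_system_sMinus_autCore` = `hSys⁹`, offered as OFFER-M v1.11; its census in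
`CMPointSystemPiPrimeClass.lean` lists Tian's Notations (ii) — conjunct `hsq` of `GenusTheoryDisplaysCore`, «`t` is a
square iff `σ_t` fixes `√p` and `√−q`» — among the sentences NOT derivable, «the `2`-rank, a different datum»). It IS
derivable on `𝒮⁻`, from the finiteness of the class group `𝒜` (Mathlib; already a hypothesis of the consumer
`Monsky1990.classGroupFacts_of_genusTheory [Fintype G]`) and the other displayed sentences:
* («`t ∈ 2𝒜` ⟹ `σ_t` fixes `√p`, `√−q`») is a tautology of the data: an automorphism sends a square root to `±` itself, so a
  square fixes it (`map_sq_sqrt`).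
* («`σ_t` fixes `√p`, `√−q` ⟹ `t ∈ 2𝒜`») is the index argument of genus theory, here in the kernel: the fixing subgroup
  `K = {t : σ_t(√p) = √p, σ_t(√−q) = √−q}` contains `2𝒜`; `[𝒜 : 2𝒜] = #𝒜[2] ≤ 4` by Notations (i) as displayed
  (`𝒜[2] ⊆ {1, [ϖ′], [𝔭_p], [𝔭_q]}`); `[𝒜 : K] ≥ 4` because `1, [𝔭_p], [𝔭_q], [𝔭_p][𝔭_q]` are pairwise incongruent modulo
  `K` — their «genus characters» `(σ(√p)/√p, σ(√−q)/√−q)` are `(+,+)`, `(+,−)`, `(−,ε)`, `(−,−ε)` by the genus rule (iii) on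
  `𝒮⁻` (`Monsky1990.ramifiedClassActions_of_genusRule`: `σ_{[𝔭_p]}` fixes `√p`, negates `√−q`; `σ_{[𝔭_q]}` negates `√p`);
  hence `K = 2𝒜` (`isSquare_iff_fixes_of_twoTorsion_of_genusRule`). The orders `[𝔭_p]² = [𝔭_q]² = 1` are NOT used.
So on `𝒮⁻` Gauss's principal-genus theorem for `K = ℚ(√−2pq)` («the principal genus consists of the squares», Tian's
«`2𝒜 ≃ Gal(H/H₀)`») is a consequence of the ambiguous-class listing (i) and the genus-character values (iii) — the
classical derivation, with the `2`-rank pinned by (i). The display WITHOUT the sentence — `GenusTheoryDisplaysBase`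
(thirteen conjuncts, a byte-identical sub-conjunction of `GenusTheoryDisplaysCore`) — gives the named fact
`tian2014_system_sMinus_autBase` (`hSys¹⁰`), EQUIVALENT to `hSys⁹` (and so to `hSys⁸`, `hSys⁷`) in the kernel:
`tian2014_system_sMinus_autCore_iff_autBase`, `tian2014_system_sMinus_aut_iff_autBase`. The reading carriers of record
(P `tyzPhiParam`, M5 `tyzZN`, inside `GrossZagierAut`) are displayed verbatim as before; `PrintedCore` is untouched.

WHAT REMAINS (the census of `CMPointSystemPiPrimeClass.lean`, corrected by this one sentence — no minimality claimed):
the four printed relations among the points `z_t` (`thm28_1`–`thm28_3`, `eq48`), the Galois facts on `i`, `√−2n` and the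
generation of `Gal(H(i)/K)` (`galoisFactsCore`), every `GrossZagierAut` conjunct, and in the genus display the witnesses
`√p, √−q ∈ H(i)`, the orders `[𝔭_p]² = [𝔭_q]² = 1` (unconstrained by the rest: `𝒜` could have `[𝔭_p]` of order `8` with
`[𝔭_p]⁴ = [ϖ′]`), the listing (i) (the bound `#𝒜[2] ≤ 4` is the content; it is NOT recoverable from (ii)+(iii) without
`[ϖ′] = [𝔭_p][𝔭_q]`, which `hSys⁹` already derives from (i)), the genus rule (iii) at the four pairs, and the actions of
`σ_{1+ϖ}`, `c` on `√p`, `√−q`.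

HONEST FRAMING (README §1 of the cell): nothing asserted; every `def … : Prop` below is a sub-conjunction of a display
already in the tree (`CMPointSystemGenusBridge.lean`, `CMPointSystemPiPrimeClass.lean`) with the same locators; the kernel
content is finite-group arithmetic (indices of the subgroup of squares and of a fixing subgroup). No `_holds`; the
conjecture `Prop`s stay `@[conjecture]`.
[cite: Tian2014, Notations (i)–(iii) (J122 L41–54 = p0005 L22–L41), Thm. 2.8 (p0011 L37–L44 = J132), §4.2 (p0022 L47–L60)]
[cite: Monsky1990MockHeegner, p. 52 ¶2 («genus theory shows that `G²` contains an odd number of classes»), Thm. 5.5 proof (p. 62)]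
-/

noncomputable section

open scoped Classical NumberTheorySymbols

open WeierstrassCurve NumberField Literature.NumberTheory.EllipticCurves
  Literature.NumberTheory.EllipticCurves.TianYuanZhang2017

namespace Literature.NumberTheory.EllipticCurves.Monsky1990

variable {G : Type*} [CommGroup G] {H : Type*} [Field H] [CharZero H] [Algebra ℚ H]

/-! ## §1 Kernel group theory: the principal genus from the ambiguous classes and the genus characters -/

omit [CharZero H] in
/-- An automorphism sends a square root of a rational integer to `±` itself (private plumbing). [folklore] -/
private theorem map_sqrt_eq_or_eq_neg (g : H ≃ₐ[ℚ] H) {s : H} {c : ℤ} (hs : s ^ 2 = c) :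
    g s = s ∨ g s = -s := by
  have : (g s) ^ 2 = s ^ 2 := by rw [← map_pow, hs, map_intCast]
  exact sq_eq_sq_iff_eq_or_eq_neg.mp this

omit [CharZero H] in
/-- **A square acts trivially on a square root of a rational integer**: `σ_{r²}(s) = σ_r(±s) = s` — the trivial half of
Tian's Notations (ii), «`t ∈ 2𝒜` ⟹ `σ_t` fixes all `√p*_j`». [cite: Tian2014, Notations (ii) (J122 L45–50 = p0005 L27–L30)] [folklore] -/
theorem map_sq_sqrt (art : G →* (H ≃ₐ[ℚ] H)) (r : G) {s : H} {c : ℤ} (hs : s ^ 2 = c) :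
    art (r * r) s = s := by
  rw [map_mul, AlgEquiv.mul_apply]
  rcases map_sqrt_eq_or_eq_neg (art r) hs with h | h
  · rw [h, h]
  · rw [h, map_neg, h, neg_neg]

/-- **The principal-genus sentence «`t ∈ 2𝒜` iff `σ_t` fixes `√p` and `√−q`» from the `2`-torsion listing and the genus
rule (the shape of `𝒮⁻`)**: for a FINITE abelian group `G` with `art : G →* Aut(H/ℚ)`, non-zero square roots `√p`, `√−q`
in `H`, elements `cp, cq, m` with `G[2] ⊆ {1, m, cp, cq}` (Notations (i)) and the genus-character values `σ_{cp}(√p) = √p`,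
`σ_{cp}(√−q) = −√−q`, `σ_{cq}(√p) = −√p` (Notations (iii) on `𝒮⁻`), an element is a square iff it fixes `√p` and `√−q`.
Proof: the fixing subgroup `K` contains the squares `G²`; `[G : G²] = #G[2] ≤ 4`; `[G : K] ≥ 4` because the classes of
`1, cp, cq, cp·cq` in `G/K` are separated by `t ↦ (σ_t(√p), σ_t(√−q))`; so `K = G²`. The orders of `cp`, `cq` are not used.
[cite: Tian2014, Notations (i)–(iii) (J122 L41–54 = p0005 L22–L41)] [cite: Monsky1990MockHeegner, p. 52 ¶2] [folklore] -/
theorem isSquare_iff_fixes_of_twoTorsion_of_genusRule [Finite G] (art : G →* (H ≃ₐ[ℚ] H))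
    {p q : ℕ} {sqrtP sqrtNegQ : H} (hP : sqrtP ^ 2 = p) (hQ : sqrtNegQ ^ 2 = -q)
    (hsP : sqrtP ≠ 0) (hsQ : sqrtNegQ ≠ 0) {cp cq m : G}
    (h2tor : ∀ t : G, t * t = 1 → t = 1 ∨ t = m ∨ t = cp ∨ t = cq)
    (hcpP : art cp sqrtP = sqrtP) (hcpQ : art cp sqrtNegQ = -sqrtNegQ) (hcqP : art cq sqrtP = -sqrtP) :
    ∀ t : G, IsSquare t ↔ (art t sqrtP = sqrtP ∧ art t sqrtNegQ = sqrtNegQ) := by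
  have hP' : sqrtP ^ 2 = ((p : ℤ) : H) := by rw [hP]; push_cast; rfl
  have hQ' : sqrtNegQ ^ 2 = ((-q : ℤ) : H) := by rw [hQ]; push_cast; rfl
  -- the fixing subgroup `K`
  let K : Subgroup G :=
    { carrier := {t | art t sqrtP = sqrtP ∧ art t sqrtNegQ = sqrtNegQ}
      one_mem' := by simp
      mul_mem' := fun {a b} ha hb => by
        simp only [Set.mem_setOf_eq, map_mul, AlgEquiv.mul_apply] at ha hb ⊢
        rw [hb.1, ha.1, hb.2, ha.2]; exact ⟨rfl, rfl⟩
      inv_mem' := fun {a} ha => by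
        simp only [Set.mem_setOf_eq] at ha ⊢
        constructor
        · have := congrArg (art a⁻¹) ha.1
          rw [← AlgEquiv.mul_apply, ← map_mul, inv_mul_cancel, map_one, AlgEquiv.one_apply] at this
          exact this.symm
        · have := congrArg (art a⁻¹) ha.2
          rw [← AlgEquiv.mul_apply, ← map_mul, inv_mul_cancel, map_one, AlgEquiv.one_apply] at this
          exact this.symm }
  have hK : ∀ t, t ∈ K ↔ (art t sqrtP = sqrtP ∧ art t sqrtNegQ = sqrtNegQ) := fun t => Iff.rfl
  -- the subgroup of squares `G²` (the range of `t ↦ t²`) and the `2`-torsion `G[2]` (its kernel)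
  let f : G →* G := powMonoidHom 2
  have hf : ∀ t, f t = t * t := fun t => by simp [f, powMonoidHom_apply, sq]
  have hRK : f.range ≤ K := by
    rintro t ⟨r, rfl⟩
    rw [hK, hf]
    exact ⟨map_sq_sqrt art r hP', map_sq_sqrt art r hQ'⟩
  -- `[G : G²] = #G[2] ≤ 4`
  have hker : (f.ker : Set G) ⊆ {1, m, cp, cq} := by
    intro t ht
    rw [SetLike.mem_coe, MonoidHom.mem_ker, hf] at ht
    rcases h2tor t ht with h | h | h | h <;> simp [h]
  have hcardker : Nat.card f.ker ≤ 4 := by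
    rw [← SetLike.coe_sort_coe, Nat.card_coe_set_eq]
    refine le_trans (Set.ncard_le_ncard hker (Set.toFinite _)) ?_
    refine le_trans (Set.ncard_insert_le _ _) ?_
    refine le_trans (Nat.add_le_add_right (Set.ncard_insert_le _ _) 1) ?_
    refine le_trans (Nat.add_le_add_right (Nat.add_le_add_right (Set.ncard_insert_le _ _) 1) 1) ?_
    rw [Set.ncard_singleton]
  have hRindex : f.range.index = Nat.card f.ker := by
    have h1 := Subgroup.card_mul_index f.range
    have h2 := Subgroup.card_mul_index f.ker
    rw [Subgroup.index_ker] at h2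
    have hpos : 0 < Nat.card f.range := Nat.card_pos (α := f.range)
    have : Nat.card f.range * f.range.index = Nat.card f.range * Nat.card f.ker := by
      rw [h1, ← h2, mul_comm]
    exact Nat.eq_of_mul_eq_mul_left hpos this
  have hRle : f.range.index ≤ 4 := hRindex ▸ hcardker
  -- `[G : K] ≥ 4`: `t ↦ (σ_t(√p), σ_t(√−q))` is well defined on `G/K` and separates `1, cp, cq, cp·cq`
  let ψ : G ⧸ K → H × H := Quotient.lift (fun t : G => (art t sqrtP, art t sqrtNegQ)) (by
    intro a b hab
    have hab' : a⁻¹ * b ∈ K := QuotientGroup.leftRel_apply.mp hab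
    obtain ⟨h1, h2⟩ := (hK _).mp hab'
    have hb : b = a * (a⁻¹ * b) := (mul_inv_cancel_left a b).symm
    rw [hb, map_mul, AlgEquiv.mul_apply, AlgEquiv.mul_apply, h1, h2])
  let e : Fin 4 → G := ![1, cp, cq, cp * cq]
  have hψ : ∀ t : G, ψ (QuotientGroup.mk t) = (art t sqrtP, art t sqrtNegQ) := fun t => rfl
  have hy0 : art cq sqrtNegQ ≠ 0 := (map_ne_zero _).mpr hsQ
  have hneP : -sqrtP ≠ sqrtP := fun h => hsP (CharZero.neg_eq_self_iff.mp h)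
  have hneQ : -sqrtNegQ ≠ sqrtNegQ := fun h => hsQ (CharZero.neg_eq_self_iff.mp h)
  have hney : -(art cq sqrtNegQ) ≠ art cq sqrtNegQ := fun h => hy0 (CharZero.neg_eq_self_iff.mp h)
  have hcpcqQ : art cp (art cq sqrtNegQ) = -(art cq sqrtNegQ) := by
    rw [← AlgEquiv.mul_apply, ← map_mul, mul_comm, map_mul, AlgEquiv.mul_apply, hcpQ, map_neg]
  have hinj : Function.Injective (fun i : Fin 4 => (QuotientGroup.mk (e i) : G ⧸ K)) := by
    have hinj' : Function.Injective (ψ ∘ fun i : Fin 4 => (QuotientGroup.mk (e i) : G ⧸ K)) := by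
      intro i j hij
      simp only [Function.comp, hψ] at hij
      fin_cases i <;> fin_cases j <;>
        simp [e, hcpP, hcpQ, hcqP, hcpcqQ, hneP, hneP.symm, hneQ, hneQ.symm, hney, hney.symm,
          Prod.ext_iff] at hij ⊢
    exact hinj'.of_comp
  have hKge : 4 ≤ K.index := by
    rw [Subgroup.index_eq_card]
    have := Nat.card_le_card_of_injective _ hinj
    simpa using this
  -- conclude `K = G²`
  have hKR : K.index ≤ f.range.index := by
    have hdvd := Subgroup.index_dvd_of_le hRK
    have hne : f.range.index ≠ 0 := Subgroup.index_ne_zero_of_finite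
    exact Nat.le_of_dvd (Nat.pos_of_ne_zero hne) hdvd
  have hKeq : K.index = f.range.index := le_antisymm hKR (le_trans hRle hKge)
  have hrel : f.range.relIndex K = 1 := by
    have h := Subgroup.relIndex_mul_index hRK
    rw [← hKeq] at h
    have hne : K.index ≠ 0 := Subgroup.index_ne_zero_of_finite
    have : f.range.relIndex K * K.index = 1 * K.index := by rw [one_mul]; exact h
    exact Nat.eq_of_mul_eq_mul_right (Nat.pos_of_ne_zero hne) this
  have hKR' : K ≤ f.range := Subgroup.relIndex_eq_one.mp hrel
  intro t
  constructor
  · rintro ⟨r, rfl⟩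
    exact ⟨map_sq_sqrt art r hP', map_sq_sqrt art r hQ'⟩
  · intro ht
    obtain ⟨r, hr⟩ := hKR' ((hK t).mpr ht)
    exact ⟨r, by rw [← hr, hf]⟩

end Literature.NumberTheory.EllipticCurves.Monsky1990

namespace Literature.NumberTheory.EllipticCurves.Tian2014

namespace CMPointData

/-! ## §2 The genus-theory display without the principal-genus sentence -/

/-- **The genus theory of `K = ℚ(√−2pq)` on `𝒮⁻` as Tian prints it, WITHOUT the principal-genus sentence «`t ∈ 2𝒜` iff
`σ_t` fixes `√p`, `√−q`» (Notations (ii)) and without the derived sentence «`[ϖ′] = [𝔭_p]·[𝔭_q]`»**: the thirteen other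
conjuncts of `GenusTheoryDisplaysCore` verbatim — `√p, √−q ∈ H(i)`; `[𝔭_p]² = [𝔭_q]² = 1` and `𝒜[2] ⊆ {1, [ϖ′], [𝔭_p],
[𝔭_q]}` (Notations (i)); the genus rule at the four pairs `(d, ℓ) ∈ {p, q}²` (Notations (iii)); `σ_{1+ϖ}` fixes `√p`,
`√−q`; complex conjugation fixes `√p`, negates `√−q`. The removed sentence (ii) is PROVED on `𝒮⁻` from (i), (iii) and the
finiteness of `𝒜` (`isSquare_iff_fixes_of_genusTheoryDisplaysBase`).
[cite: Tian2014, Notations (J122 L26–54 = p0005 L5–L41; J123 L4–L15 = p0005 L47–L59), Thm. 2.8 (1)(2) (p0011 L39–L41)]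
[cite: Monsky1990MockHeegner, p. 52 ¶2] -/
def GenusTheoryDisplaysBase {p q : ℕ} (D : CMPointData (p * q)) : Prop :=
  ∃ (sqrtP sqrtNegQ : D.H) (cp cq : ClassGroup (𝓞 (GenusField (2 * (p * q))))),
    sqrtP ^ 2 = p ∧ sqrtNegQ ^ 2 = -q ∧ cp * cp = 1 ∧ cq * cq = 1 ∧
    (∀ t : ClassGroup (𝓞 (GenusField (2 * (p * q)))), t * t = 1 → t = 1 ∨ t = D.piPrime ∨ t = cp ∨ t = cq) ∧
    (D.art cp sqrtP = sqrtP ↔ J(2 * q | p) = 1) ∧ (D.art cp sqrtNegQ = sqrtNegQ ↔ J(p | q) = 1) ∧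
    (D.art cq sqrtP = sqrtP ↔ J(q | p) = 1) ∧ (D.art cq sqrtNegQ = sqrtNegQ ↔ J(2 * p | q) = 1) ∧
    D.tau sqrtP = sqrtP ∧ D.tau sqrtNegQ = sqrtNegQ ∧ D.conj sqrtP = sqrtP ∧ D.conj sqrtNegQ = -sqrtNegQ

/-- The base genus display is a sub-conjunction of `GenusTheoryDisplaysCore` (projection).
[cite: Tian2014, Notations (J122–123)] [folklore] -/
theorem genusTheoryDisplaysBase_of_genusTheoryDisplaysCore {p q : ℕ} (D : CMPointData (p * q))
    (h : D.GenusTheoryDisplaysCore) : D.GenusTheoryDisplaysBase := by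
  obtain ⟨sqrtP, sqrtNegQ, cp, cq, hPs, hQs, hcp2, hcq2, h2tor, -, r1, r2, r3, r4, hτP, hτQ, hcP, hcQ⟩ := h
  exact ⟨sqrtP, sqrtNegQ, cp, cq, hPs, hQs, hcp2, hcq2, h2tor, r1, r2, r3, r4, hτP, hτQ, hcP, hcQ⟩

/-! ## §3 The principal-genus sentence is a theorem of Notations (i) and (iii) on `𝒮⁻` -/

/-- **«`t ∈ 2𝒜` iff `σ_t` fixes `√p` and `√−q`» (Tian's Notations (ii)) is a KERNEL THEOREM of Notations (i) and (iii)
on `𝒮⁻`**: the class group of `K = ℚ(√−2pq)` is finite; (i) bounds `#𝒜[2] ≤ 4`, i.e. `[𝒜 : 2𝒜] ≤ 4`; the genus rule (iii)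
at the four pairs gives `σ_{[𝔭_p]}(√p) = √p`, `σ_{[𝔭_p]}(√−q) = −√−q`, `σ_{[𝔭_q]}(√p) = −√p`
(`Monsky1990.ramifiedClassActions_of_genusRule`), so the fixing subgroup of `√p`, `√−q` has index `≥ 4` and equals `2𝒜`.
[cite: Tian2014, Notations (i)–(iii) (J122 L41–54 = p0005 L22–L41)] [cite: Monsky1990MockHeegner, p. 52 ¶2] -/
theorem isSquare_iff_fixes_of_twoTorsion_of_genusRule {p q : ℕ} (D : CMPointData (p * q)) (hp : p.Prime)
    (hq : q.Prime) (hp8 : p % 8 = 5) (hq4 : q % 4 = 3) (hpq : J(p | q) = -1) {sqrtP sqrtNegQ : D.H}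
    (hPs : sqrtP ^ 2 = p) (hQs : sqrtNegQ ^ 2 = -q) {cp cq : ClassGroup (𝓞 (GenusField (2 * (p * q))))}
    (h2tor : ∀ t : ClassGroup (𝓞 (GenusField (2 * (p * q)))), t * t = 1 → t = 1 ∨ t = D.piPrime ∨ t = cp ∨ t = cq)
    (r1 : D.art cp sqrtP = sqrtP ↔ J(2 * q | p) = 1) (r2 : D.art cp sqrtNegQ = sqrtNegQ ↔ J(p | q) = 1)
    (r3 : D.art cq sqrtP = sqrtP ↔ J(q | p) = 1) (r4 : D.art cq sqrtNegQ = sqrtNegQ ↔ J(2 * p | q) = 1) :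
    ∀ t, IsSquare t ↔ (D.art t sqrtP = sqrtP ∧ D.art t sqrtNegQ = sqrtNegQ) := by
  obtain ⟨hsP, hsQ⟩ := Monsky1990.sqrt_ne_zero_of_prime hp hq hPs hQs
  obtain ⟨hcpP, hcpQ, hcqP, -⟩ :=
    Monsky1990.ramifiedClassActions_of_genusRule D.art hp8 hq4 hpq hPs hQs r1 r2 r3 r4
  exact Monsky1990.isSquare_iff_fixes_of_twoTorsion_of_genusRule D.art hPs hQs hsP hsQ h2tor hcpP hcpQ hcqP

/-- **The principal-genus sentence from the base genus display on `𝒮⁻`** (for the witnesses of the display).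
[cite: Tian2014, Notations (i)–(iii) (J122 L41–54)] -/
theorem genusTheoryDisplaysCore_of_genusTheoryDisplaysBase {p q : ℕ} (D : CMPointData (p * q)) (hp : p.Prime)
    (hq : q.Prime) (hp8 : p % 8 = 5) (hq4 : q % 4 = 3) (hpq : J(p | q) = -1) (h : D.GenusTheoryDisplaysBase) :
    D.GenusTheoryDisplaysCore := by
  obtain ⟨sqrtP, sqrtNegQ, cp, cq, hPs, hQs, hcp2, hcq2, h2tor, r1, r2, r3, r4, hτP, hτQ, hcP, hcQ⟩ := h
  exact ⟨sqrtP, sqrtNegQ, cp, cq, hPs, hQs, hcp2, hcq2, h2tor,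
    D.isSquare_iff_fixes_of_twoTorsion_of_genusRule hp hq hp8 hq4 hpq hPs hQs h2tor r1 r2 r3 r4,
    r1, r2, r3, r4, hτP, hτQ, hcP, hcQ⟩

/-- The core and the base genus displays are equivalent on `𝒮⁻`. [cite: Tian2014, Notations (i)–(iii) (J122 L41–54)] -/
theorem genusTheoryDisplaysCore_iff_genusTheoryDisplaysBase {p q : ℕ} (D : CMPointData (p * q)) (hp : p.Prime)
    (hq : q.Prime) (hp8 : p % 8 = 5) (hq4 : q % 4 = 3) (hpq : J(p | q) = -1) :
    D.GenusTheoryDisplaysCore ↔ D.GenusTheoryDisplaysBase :=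
  ⟨D.genusTheoryDisplaysBase_of_genusTheoryDisplaysCore,
    D.genusTheoryDisplaysCore_of_genusTheoryDisplaysBase hp hq hp8 hq4 hpq⟩

/-- `GenusTheoryDisplays` (the fifteen-conjunct display of `CMPointSystemGenusBridge.lean`) and the base display are
equivalent on `𝒮⁻`. [cite: Tian2014, Notations (i)–(iii) (J122 L41–54), §4.2 (p0022 L58–L60)] -/
theorem genusTheoryDisplays_iff_genusTheoryDisplaysBase {p q : ℕ} (D : CMPointData (p * q)) (hp : p.Prime)
    (hq : q.Prime) (hp8 : p % 8 = 5) (hq4 : q % 4 = 3) (hpq : J(p | q) = -1) :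
    D.GenusTheoryDisplays ↔ D.GenusTheoryDisplaysBase :=
  (D.genusTheoryDisplays_iff_genusTheoryDisplaysCore hp hq hp8 hq4 hpq).trans
    (D.genusTheoryDisplaysCore_iff_genusTheoryDisplaysBase hp hq hp8 hq4 hpq)

end CMPointData

/-! ## §4 The aut system fact with the base genus display -/

/-- **THE AUT SYSTEM FACT WITH THE PRINCIPAL-GENUS SENTENCE REMOVED AS WELL**: as `tian2014_system_sMinus_autCore` (Tian's
CM-point system on `𝒮⁻`: `PrintedCore` — Thm. 2.8 (1)–(3), (4.8), the Galois facts on `i`, `√−2n` and the generation of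
`Gal(H(i)/K)` —, `GrossZagierAut` — TYZ Thm. 3.3 at `χ₀` + TYZ p. 749 through `ϕ` + the bridge displays with M2, M4, M7
split into printed sentences — and the genus theory of `K = ℚ(√−2pq)` as printed) with `GenusTheoryDisplaysCore` replaced
by `GenusTheoryDisplaysBase`: WITHOUT Tian's Notations (ii) «`2𝒜 ≃ Gal(H/H₀)`, i.e. `t ∈ 2𝒜` iff `σ_t` fixes all `√p*_j`»,
which the base display proves on `𝒮⁻` (Gauss's principal-genus theorem for this field from (i) and (iii)). Existential over
ONE system per `(p, q)`; EQUIVALENT to `tian2014_system_sMinus_autCore`, `…_autReduced` and `…_aut`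
(`tian2014_system_sMinus_autCore_iff_autBase`, `tian2014_system_sMinus_aut_iff_autBase`), hence implies `…_param`,
`…_cusp`, `…_maximal`, `…_bridged`, `…_split`, `…_genus` and every enclosure form of the cell. Printed-but-unproved content
= that of the core aut fact minus the one sentence. Nothing asserted; no `_holds` expected.
[cite: Tian2014, Def. 2.7, Thm. 2.8 (p0011 L25–L44 = J132), Prop. 2.1 (p0006 L23–L75 = J124 L25–J125 L35), p0007 L22–L29 (J126 L2–L7), p0003 L1–L5, §2 (p0005 L77–L79), §4.2 (p0022 L52–L60), (4.8) (p0023 L46–L50), Notations (i)–(iii) (J122 L41–54)]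
[cite: TianYuanZhang2017, Thm. 3.3 (p. 739) and its proof (pp. 749–751), §2 (p0007 L112), §3.1, §3.2 (p0012 L8–L18), J747, J751, Lemma 3.16 (p0017 L98–L113), Thm. 1.1, Thm. 1.4] -/
def tian2014_system_sMinus_autBase : Prop :=
  ∀ p q : ℕ, (hp : p.Prime) → (hq : q.Prime) → p % 8 = 5 → q % 4 = 3 → jacobiSym p q = -1 →
    ∃ D : CMPointData (p * q), D.PrintedCore ∧
      D.GrossZagierAut (Nat.mul_ne_zero hp.ne_zero hq.ne_zero) ∧ D.GenusTheoryDisplaysBase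

/-- The base aut fact implies the core aut fact (the principal-genus sentence is a kernel theorem of the base display on
`𝒮⁻`). [cite: Tian2014, Notations (i)–(iii) (J122 L41–54)] -/
theorem tian2014_system_sMinus_autCore_of_autBase (h : tian2014_system_sMinus_autBase) :
    tian2014_system_sMinus_autCore := by
  intro p q hp hq hp5 hq4 hj
  obtain ⟨D, hP, hG, hGen⟩ := h p q hp hq hp5 hq4 hj
  exact ⟨D, hP, hG, D.genusTheoryDisplaysCore_of_genusTheoryDisplaysBase hp hq hp5 hq4 hj hGen⟩

/-- The core aut fact implies the base aut fact (projection). [cite: Tian2014, Notations (J122–123)] [folklore] -/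
theorem tian2014_system_sMinus_autBase_of_autCore (h : tian2014_system_sMinus_autCore) :
    tian2014_system_sMinus_autBase := by
  intro p q hp hq hp5 hq4 hj
  obtain ⟨D, hP, hG, hGen⟩ := h p q hp hq hp5 hq4 hj
  exact ⟨D, hP, hG, D.genusTheoryDisplaysBase_of_genusTheoryDisplaysCore hGen⟩

/-- The core and the base aut facts are equivalent. [cite: Tian2014, Notations (i)–(iii) (J122 L41–54)] -/
theorem tian2014_system_sMinus_autCore_iff_autBase :
    tian2014_system_sMinus_autCore ↔ tian2014_system_sMinus_autBase :=
  ⟨tian2014_system_sMinus_autBase_of_autCore, tian2014_system_sMinus_autCore_of_autBase⟩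

/-- The base aut fact implies the aut fact. [cite: Tian2014, Prop. 4.6 proof (p0023 L26–L28), Thm. 2.8 (3), Notations (i)–(iii)] -/
theorem tian2014_system_sMinus_aut_of_autBase (h : tian2014_system_sMinus_autBase) :
    tian2014_system_sMinus_aut :=
  tian2014_system_sMinus_aut_of_autCore (tian2014_system_sMinus_autCore_of_autBase h)

/-- The aut fact implies the base aut fact (projection). [cite: Tian2014, Thm. 2.8 (p0011 L37–L44)] [folklore] -/
theorem tian2014_system_sMinus_autBase_of_aut (h : tian2014_system_sMinus_aut) :
    tian2014_system_sMinus_autBase :=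
  tian2014_system_sMinus_autBase_of_autCore (tian2014_system_sMinus_autCore_of_aut h)

/-- The aut fact and the base aut fact are equivalent: the displayed hypothesis of the route-A corner may be read with or
without Tian's Prop. 4.6 generation sentence, the three sentences on `[ϖ′]` and the principal-genus sentence (ii).
[cite: Tian2014, Prop. 4.6 proof (p0023 L26–L28), Thm. 2.8 (3) (p0011 L42–L44), Notations (i)–(iii) (J122 L41–54)] -/
theorem tian2014_system_sMinus_aut_iff_autBase :
    tian2014_system_sMinus_aut ↔ tian2014_system_sMinus_autBase :=
  ⟨tian2014_system_sMinus_autBase_of_aut, tian2014_system_sMinus_aut_of_autBase⟩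

/-- The reduced aut fact and the base aut fact are equivalent. [cite: Tian2014, Thm. 2.8 (3), Notations (i)–(iii) (J122 L41–54)] -/
theorem tian2014_system_sMinus_autReduced_iff_autBase :
    tian2014_system_sMinus_autReduced ↔ tian2014_system_sMinus_autBase :=
  tian2014_system_sMinus_autReduced_iff_autCore.trans tian2014_system_sMinus_autCore_iff_autBase

/-- The base aut fact implies the maximal fact. [cite: Tian2014, Prop. 2.1, Prop. 4.6 proof (p0023 L26–L28), Notations (i)–(iii)] [cite: TianYuanZhang2017, §2, §3.2, Lemma 3.16] -/
theorem tian2014_system_sMinus_maximal_of_autBase (h : tian2014_system_sMinus_autBase) :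
    tian2014_system_sMinus_maximal :=
  tian2014_system_sMinus_maximal_of_aut (tian2014_system_sMinus_aut_of_autBase h)

end Literature.NumberTheory.EllipticCurves.Tian2014

end
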